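import Mathlib
/-!
# Toric chart certificates — definitions: cone data, words, the presented cone ring, certificates

(crux stmt-ResolutionOfSingularities-15640 `WildQuotients.WildQuotientResolution`, line `Sketch`,
sector `|G| = p`; next rung R-T of `L/w45c/CHAIN.md` v8 §5 (III) — the cone lane. This is the
«SOUNDNESS to prove once» asked for by idea-2's card J (`one-shot-monomial-exit`): a chart
certificate produced by an exact toric engine is CHECKED by the kernel (`decide`), and the companion
files `…ToricChartLemmas / …ToricChartRegular / …ToricChartCover` turn valid certificates into
`IsRegularRing` of the chart rings and
`Scheme.IsRegular (affineBlowup 𝔞) ∧ IsIntegral ∧ IsProper ∧ IsBirational`. First client: the `μ₄`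
vertex piece `¼(1,1,2,3) × 𝔸^P` of `Y(J₅)` (`…Quarter1123*`). [OURS · L1 W4.5c] — NOT a statement
of any manuscript; replaces the role of no printed item. Owner res-L1-w45c-stub-4 (gen 4).)

A CONE DATUM `D : ConeDatum d r` presents a monomial subalgebra of `k[x_s (s : Fin d), passengers]`
by `d` pure powers `x_s ^ D.pw s` and `r` mixed monomials `x ^ (D.mx j)`, as the image of
`presentation k P D : k[Y] → k[x]`, `Y = (Fin d ⊕ P) ⊕ Fin r` (passengers `P` map to themselves;
pattern of `Third112.presentation` / `ToricExit.conePresentation`); the presented ring is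
`ToricChart.Ring k P D = k[Y] ⧸ ker`. A WORD `w : Word d r` is a multiplicity vector on the cone
symbols, `wordExp D w : Fin d → ℕ` its `x`-exponent, `wordElem k P D w` its class in the ring. A
monomial CENTRE is `(wordElem (G l))_l` for `G : Fin m → Word d r`.

* `ChartCert d r m`, `ChartCert.check` — certificate for the vertex chart `D₊(cc j₀ · t)` and its
  Boolean checker (identities of natural numbers / integers only): the chart coordinates are
  `u_s = num s / (cc j₀)^{K s}` (`num s = ∏_l cc l ^ numG s l · wordElem (numW s)`), the tables
  `lamP / lamM / mu` write the cone symbols and the fractions `cc l / cc j₀` as monomials in the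
  `u_s`, and `Binv` is `det` times the inverse of the Laurent exponent matrix of the `u_s`.
* `RelCert d r m`, `RelCert.check` — Rees relation `L·g_l = Σ κ_i g_i + (cone word)` placing the
  chart of a (non-vertex) generator inside a vertex chart.
* `fsum` — finite sums by structural recursion (kernel-evaluable); `xmon`, `theta`, `Laurent`,
  `toLaurent`, `pureWord`, `mixedWord` — auxiliary objects of the soundness proofs.
-/

-- single-problem summit: the doubled namespace component `ResolutionOfSingularities` is forced
set_option linter.dupNamespace false

noncomputable section

open MvPolynomial

namespace Summit.ResolutionOfSingularities.ResolutionOfSingularities.Theorems.WildQuotientResolution.ToricChart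

variable {d r : ℕ}

/-! ## Finite sums that the kernel evaluates -/

/-- `fsum n f = f 0 + f 1 + ⋯ + f (n-1)`, by structural recursion (reduces in the kernel).
[folklore] -/
def fsum {α : Type} [Zero α] [Add α] : (n : ℕ) → (Fin n → α) → α
  | 0, _ => 0
  | n + 1, f => f 0 + fsum n fun i => f i.succ

/-! ## Cone data, words, exponents -/

/-- A CONE DATUM: `d` pure powers `x_s ^ pw s` and `r` mixed monomials `x ^ (mx j)` generating a
monomial subalgebra of `k[x_s (s : Fin d)]` (e.g. the invariant ring of a cyclic quotient
singularity, given by its Hilbert basis). [OURS · L1 W4.5c] -/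
structure ConeDatum (d r : ℕ) where
  /-- the pure powers: symbol `inl s ↦ x_s ^ pw s` -/
  pw : Fin d → ℕ
  /-- the mixed monomials: symbol `inr j ↦ ∏ x_s ^ mx j s` -/
  mx : Fin r → Fin d → ℕ

/-- A WORD in the cone symbols: multiplicities of the pure symbols and of the mixed symbols.
[OURS · L1 W4.5c] -/
structure Word (d r : ℕ) where
  /-- multiplicity of the pure symbol `inl s` -/
  wp : Fin d → ℕ
  /-- multiplicity of the mixed symbol `inr j` -/
  wm : Fin r → ℕ

/-- The `x`-exponent of a word. [OURS · L1 W4.5c] -/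
def wordExp (D : ConeDatum d r) (w : Word d r) (s : Fin d) : ℕ :=
  D.pw s * w.wp s + fsum r fun j => w.wm j * D.mx j s

/-- The word of the pure symbol `inl s'`. [OURS · L1 W4.5c] -/
def pureWord (s' : Fin d) : Word d r := ⟨fun s => if s = s' then 1 else 0, fun _ => 0⟩

/-- The word of the mixed symbol `inr j`. [OURS · L1 W4.5c] -/
def mixedWord (j : Fin r) : Word d r := ⟨fun _ => 0, fun j' => if j' = j then 1 else 0⟩

section Ring

variable (k : Type) [Field k] (P : Type) (D : ConeDatum d r)

/-- The presentation `k[Y] → k[x, passengers]`, `Y = (Fin d ⊕ P) ⊕ Fin r`: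
`inl (inl s) ↦ x_s ^ pw s`, `inl (inr p) ↦ X p`, `inr j ↦ ∏ x_s ^ mx j s`. [OURS · L1 W4.5c] -/
def presentation : MvPolynomial ((Fin d ⊕ P) ⊕ Fin r) k →ₐ[k] MvPolynomial (Fin d ⊕ P) k :=
  MvPolynomial.aeval (Sum.elim
    (Sum.elim (fun s => X (Sum.inl s) ^ D.pw s) (fun p => X (Sum.inr p)))
    (fun j => ∏ s : Fin d, X (Sum.inl s) ^ D.mx j s))

/-- The presented cone ring `A = k[Y] ⧸ ker (presentation)` (`≅` the monomial algebra tensor the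
passengers, by `RingHom.quotientKerEquivRange`). [OURS · L1 W4.5c] -/
abbrev Ring : Type := MvPolynomial ((Fin d ⊕ P) ⊕ Fin r) k ⧸ RingHom.ker (presentation k P D)

/-- The monomial `∏ x_s ^ e s` of an exponent vector. [folklore] -/
def xmon (e : Fin d → ℕ) : MvPolynomial (Fin d ⊕ P) k := ∏ s : Fin d, X (Sum.inl s) ^ e s

/-- The monomial in the symbols of a word. [OURS · L1 W4.5c] -/
def wordPoly (w : Word d r) : MvPolynomial ((Fin d ⊕ P) ⊕ Fin r) k :=
  (∏ s : Fin d, X (Sum.inl (Sum.inl s)) ^ w.wp s) * ∏ j : Fin r, X (Sum.inr j) ^ w.wm j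

/-- The class in `A` of the monomial of a word. [OURS · L1 W4.5c] -/
def wordElem (w : Word d r) : Ring k P D :=
  Ideal.Quotient.mk _ (wordPoly k P w)

variable {k P D}

/-- The induced INJECTIVE map `θ : A → k[x]` of the presentation. [folklore] -/
def theta : Ring k P D →ₐ[k] MvPolynomial (Fin d ⊕ P) k :=
  Ideal.Quotient.liftₐ (RingHom.ker (presentation k P D)) (presentation k P D) fun _ h => h

end Ring

/-! ## Laurent polynomials -/

/-- The Laurent polynomial ring `k[x_v^{±1}]`. [folklore] -/
abbrev Laurent (k : Type) [Field k] (V : Type) : Type := AddMonoidAlgebra k (V →₀ ℤ)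

/-- The canonical embedding `k[x] → k[x^{±1}]`. [folklore] -/
def toLaurent (k : Type) [Field k] (V : Type) : MvPolynomial V k →ₐ[k] Laurent k V :=
  MvPolynomial.aeval fun v => AddMonoidAlgebra.single (Finsupp.single v (1 : ℤ)) (1 : k)

/-! ## Chart certificates -/

/-- A CHART CERTIFICATE for the vertex chart `D₊(cc j₀ · t)` of the blow-up of the cone of `D`
along the monomial centre `cc = wordElem ∘ G`, `G : Fin m → Word d r`: the chart coordinates are
`u_s = (∏_l cc l ^ numG s l) · wordElem (numW s) / (cc j₀) ^ K s` (`s : Fin d`), the tables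
`lamP / lamM / mu` write every pure symbol / mixed symbol / fraction `cc l / cc j₀` as a monomial in
the `u_s`, and `Binv` is `det` times the inverse of the integer exponent matrix of the `u_s`.
[OURS · L1 W4.5c] -/
structure ChartCert (d r m : ℕ) where
  /-- `ι`-power (denominator `(cc j₀)^K s`) of the chart coordinate `u_s` -/
  K : Fin d → ℕ
  /-- multiplicities of the centre generators in the numerator of `u_s` (sum `= K s`) -/
  numG : Fin d → Fin m → ℕ
  /-- the cone word in the numerator of `u_s` -/
  numW : Fin d → Word d r
  /-- pure symbol `inl s'` `= ∏_s u_s ^ lamP s' s` -/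
  lamP : Fin d → Fin d → ℕ
  /-- mixed symbol `inr j` `= ∏_s u_s ^ lamM j s` -/
  lamM : Fin r → Fin d → ℕ
  /-- `cc l / cc j₀ = ∏_s u_s ^ mu l s` -/
  mu : Fin m → Fin d → ℕ
  /-- a non-zero integer (a multiple of the index of the exponent lattice) -/
  det : ℤ
  /-- `det` times a right inverse of the exponent matrix `b s t = nexp s t − K s · g₀ t` -/
  Binv : Fin d → Fin d → ℤ

namespace ChartCert

variable {m : ℕ} (C : ChartCert d r m) (D : ConeDatum d r) (G : Fin m → Word d r) (j₀ : Fin m)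

/-- The `x`-exponent of the numerator of the chart coordinate `u_s`, at the variable `t`.
[OURS · L1 W4.5c] -/
def nexp (s t : Fin d) : ℕ :=
  (fsum m fun l => C.numG s l * wordExp D (G l) t) + wordExp D (C.numW s) t

/-- **The checker of a chart certificate** — finitely many identities between natural numbers /
integers, evaluated by the kernel (`decide` / `rfl`). [OURS · L1 W4.5c] -/
def check : Bool :=
  decide ((∀ s : Fin d, fsum m (C.numG s) = C.K s) ∧
  (∀ s' t : Fin d, wordExp D (pureWord s') t +
      (fsum d fun s => C.lamP s' s * C.K s) * wordExp D (G j₀) t =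
    fsum d fun s => C.lamP s' s * C.nexp D G s t) ∧
  (∀ (j : Fin r) (t : Fin d), wordExp D (mixedWord j) t +
      (fsum d fun s => C.lamM j s * C.K s) * wordExp D (G j₀) t =
    fsum d fun s => C.lamM j s * C.nexp D G s t) ∧
  (∀ (l : Fin m) (t : Fin d), wordExp D (G l) t +
      (fsum d fun s => C.mu l s * C.K s) * wordExp D (G j₀) t =
    (fsum d fun s => C.mu l s * C.nexp D G s t) + wordExp D (G j₀) t) ∧
  C.det ≠ 0 ∧
  (∀ s u : Fin d, (fsum d fun t => ((C.nexp D G s t : ℤ) - C.K s * wordExp D (G j₀) t) * C.Binv t u) =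
    if s = u then C.det else 0))

end ChartCert

/-- The numerator `∏_l cc l ^ numG s l · wordElem (numW s)` of the chart coordinate `u_s`.
[OURS · L1 W4.5c] -/
def num (k : Type) [Field k] (P : Type) (D : ConeDatum d r) {m : ℕ} (G : Fin m → Word d r)
    (C : ChartCert d r m) (s : Fin d) : Ring k P D :=
  (∏ l : Fin m, wordElem k P D (G l) ^ C.numG s l) * wordElem k P D (C.numW s)

/-! ## Rees relation certificates -/

/-- A REES RELATION CERTIFICATE for a generator `cc l` relative to a vertex `cc j`:
`L · wordExp (G l) = Σ_i kap i · wordExp (G i) + wordExp W` with `Σ kap = L` and `kap j ≥ 1`, i.e.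
`(cc l · t)^L = (∏ (cc i · t)^{kap i}) · wordElem W` in the Rees algebra, whence
`D₊(cc l · t) ⊆ D₊(cc j · t)`. (For `l` a vertex take `L = 1`, `kap = δ_l`, `W = 0`.) [OURS · L1 W4.5c] -/
structure RelCert (d r m : ℕ) where
  /-- the exponent `L ≥ 1` -/
  L : ℕ
  /-- multiplicities of the generators on the right (sum `= L`) -/
  kap : Fin m → ℕ
  /-- the cone word on the right (degree `0`) -/
  W : Word d r

namespace RelCert

variable {m : ℕ} (R : RelCert d r m) (D : ConeDatum d r) (G : Fin m → Word d r) (l j : Fin m)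

/-- **The checker of a relation certificate** (kernel-evaluable). [OURS · L1 W4.5c] -/
def check : Bool :=
  decide (1 ≤ R.kap j ∧ fsum m R.kap = R.L ∧
    ∀ t : Fin d, R.L * wordExp D (G l) t =
      (fsum m fun i => R.kap i * wordExp D (G i) t) + wordExp D R.W t)

end RelCert

end Summit.ResolutionOfSingularities.ResolutionOfSingularities.Theorems.WildQuotientResolution.ToricChart

end
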